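import Mathlib.Analysis.Convex.Segment
import Mathlib.LinearAlgebra.AffineSpace.Midpoint
import Literature.Probability.Percolation.LoopRotationInvariance
import HarnessLib

/-!
# The medial grid of `ℤ²`: corner cuts as `ℓ¹`-spheres around face centres

Groundwork for the lattice Jordan package of the `dkkmo_rotation_invariance` bridge (the
orientation / fatness side conditions of `LoopMatching`): the segments traced by interface loops. At mesh `1` the medial dart of the corner
`(v, f)` runs from the midpoint of one edge of the face `f` at `v` to the midpoint of the other,
i.e. it is the *corner cut* `cornerCut v f`; the four corner cuts of a face `f` are the four
closed quarter-arcs of the `ℓ¹`-sphere of radius `1/2` about the face centre `c_f = f + (½, ½)`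
(`mem_cornerCut_iff`), one in each closed quadrant. Consequently the trace of an interface loop
lies on the *medial grid* (the diagonal lines `x ± y ∈ ℤ + ½`), and two distinct corner cuts meet
at most in a common endpoint — the combinatorial reason why interface loops self-intersect only
at doubly visited medial vertices.

* `cornerCut v f`, `l1DistC` (the `ℓ¹` distance), with the prelude's `faceCenter f` (`faceCenter_re`, `faceCenter_im`);
* `mem_cornerCut_iff` (the quarter-arc description), `l1DistC_eq_of_mem_cornerCut`;
* `cornerCut_inter_subset`: two distinct corner cuts meet only at common endpoints (edge
  midpoints); hence `IsMedialDart.segment_inter_segment_subset` (distinct medial darts trace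
  segments meeting only at common medial points) and `IsMedialDart.not_symm` (a dart and its
  reverse are never both medial darts).

## References

* G. Grimmett, *Percolation* (1999), §11.2 (medial lattice of `ℤ²`).
* H. Duminil-Copin et al., arXiv:2012.11672v2 (2026), §2.3 (loop representation on the medial graph).
-/

noncomputable section

open Set Metric Complex

namespace Literature.Probability.Percolation

open LatticeModels

/-- Real part of the face centre `faceCenter f = f + (1 + i)/2` of the prelude. [folklore] -/
@[simp] theorem faceCenter_re (f : Site 2) : (faceCenter f).re = f 0 + 1 / 2 := by
  simp [faceCenter, Complex.add_re]

/-- Imaginary part of the face centre. [folklore] -/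
@[simp] theorem faceCenter_im (f : Site 2) : (faceCenter f).im = f 1 + 1 / 2 := by
  simp [faceCenter, Complex.add_im]

/-- The `ℓ¹` distance between two points of the plane (sum of coordinate distances). [folklore] -/
def l1DistC (z c : ℂ) : ℝ := |z.re - c.re| + |z.im - c.im|

/-- The **corner cut** of the corner `(v, f)` at mesh `1`: the segment from the midpoint of the
horizontal edge of `f` at `v` to the midpoint of the vertical one — the trace of the medial dart
of that corner (in either direction). [folklore] -/
def cornerCut (v f : Site 2) : Set ℂ :=
  segment ℝ (medialPoint 1 (cornerEdge v f 0)) (medialPoint 1 (cornerEdge v f 1))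

/-- The quadrant sign of a corner coordinate: `+1` if `v i = f i + 1`, `-1` if `v i = f i`. [folklore] -/
def cornerSign (v f : Site 2) (i : Fin 2) : ℝ := if v i = f i then -1 else 1

/-- Coordinates of the horizontal-edge midpoint of the corner. [folklore] -/
theorem medialPoint_cornerEdge_zero (v f : Site 2) :
    medialPoint 1 (cornerEdge v f 0) = ⟨f 0 + 1 / 2, v 1⟩ := by
  apply Complex.ext
  · simp only [cornerEdge, cornerNeighbor, medialPoint_mk, Complex.div_ofNat_re, Complex.add_re, meshPoint_re,
      Function.update_self, one_mul]
    push_cast; ring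
  · have h01 : (1 : Fin 2) ≠ 0 := by decide
    simp only [cornerEdge, cornerNeighbor, medialPoint_mk, Complex.div_ofNat_im, Complex.add_im, meshPoint_im,
      Function.update_of_ne h01, one_mul]
    ring

/-- Coordinates of the vertical-edge midpoint of the corner. [folklore] -/
theorem medialPoint_cornerEdge_one (v f : Site 2) :
    medialPoint 1 (cornerEdge v f 1) = ⟨v 0, f 1 + 1 / 2⟩ := by
  apply Complex.ext
  · have h01 : (0 : Fin 2) ≠ 1 := by decide
    simp only [cornerEdge, cornerNeighbor, medialPoint_mk, Complex.div_ofNat_re, Complex.add_re, meshPoint_re,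
      Function.update_of_ne h01, one_mul]
    ring
  · simp only [cornerEdge, cornerNeighbor, medialPoint_mk, Complex.div_ofNat_im, Complex.add_im, meshPoint_im,
      Function.update_self, one_mul]
    push_cast; ring

/-- A corner coordinate relative to the face centre is `±½` with the quadrant sign. [folklore] -/
theorem corner_sub_faceCenter {v f : Site 2} (hv : IsCorner v f) (i : Fin 2) :
    (v i : ℝ) - (f i + 1 / 2) = cornerSign v f i / 2 := by
  unfold cornerSign
  rcases hv i with h | h <;> simp [h] <;> ring

/-- **The corner cut is a quarter of the `ℓ¹`-sphere of radius `½` about the face centre**: a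
point lies on `cornerCut v f` iff its `ℓ¹` distance to `c_f` is `½` and it lies in the closed
quadrant of `v`. [folklore] -/
theorem mem_cornerCut_iff {v f : Site 2} (hv : IsCorner v f) {z : ℂ} :
    z ∈ cornerCut v f ↔ l1DistC z (faceCenter f) = 1 / 2 ∧
      0 ≤ cornerSign v f 0 * (z.re - (faceCenter f).re) ∧ 0 ≤ cornerSign v f 1 * (z.im - (faceCenter f).im) := by
  have hs0 : cornerSign v f 0 = 1 ∨ cornerSign v f 0 = -1 := by unfold cornerSign; split_ifs <;> simp
  have hs1 : cornerSign v f 1 = 1 ∨ cornerSign v f 1 = -1 := by unfold cornerSign; split_ifs <;> simp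
  have hc0 := corner_sub_faceCenter hv 0
  have hc1 := corner_sub_faceCenter hv 1
  rw [cornerCut, medialPoint_cornerEdge_zero v f, medialPoint_cornerEdge_one v f, segment_eq_image_lineMap,
    Set.mem_image]
  simp only [faceCenter_re, faceCenter_im, l1DistC]
  constructor
  · rintro ⟨t, ⟨ht0, ht1⟩, rfl⟩
    simp only [AffineMap.lineMap_apply_module, Complex.add_re, Complex.smul_re, Complex.add_im, Complex.smul_im,
      smul_eq_mul]
    -- real part: `(1-t)(f0 + 1/2) + t v0 - (f0 + 1/2) = t (v0 - f0 - 1/2) = t s0 / 2`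
    have e0 : (1 - t) * ((f 0 : ℝ) + 1 / 2) + t * (v 0 : ℝ) - ((f 0 : ℝ) + 1 / 2) = t * (cornerSign v f 0 / 2) := by
      rw [← hc0]; ring
    have e1 : (1 - t) * (v 1 : ℝ) + t * ((f 1 : ℝ) + 1 / 2) - ((f 1 : ℝ) + 1 / 2) = (1 - t) * (cornerSign v f 1 / 2) := by
      rw [← hc1]; ring
    rw [e0, e1]
    refine ⟨?_, ?_, ?_⟩
    · rcases hs0 with h0 | h0 <;> rcases hs1 with h1 | h1 <;> rw [h0, h1] <;>
        simp [abs_mul, abs_of_nonneg ht0, abs_of_nonneg (sub_nonneg.2 ht1)] <;> ring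
    · rcases hs0 with h0 | h0 <;> rw [h0] <;> nlinarith
    · rcases hs1 with h1 | h1 <;> rw [h1] <;> nlinarith
  · rintro ⟨hd, hq0, hq1⟩
    -- parameter: `t = 2 |re z - c|`
    refine ⟨2 * |z.re - ((f 0 : ℝ) + 1 / 2)|, ⟨by positivity, ?_⟩, ?_⟩
    · have : |z.im - ((f 1 : ℝ) + 1 / 2)| ≥ 0 := abs_nonneg _
      linarith
    · apply Complex.ext
      · simp only [AffineMap.lineMap_apply_module, Complex.add_re, Complex.smul_re, smul_eq_mul]
        have habs : |z.re - ((f 0 : ℝ) + 1 / 2)| = cornerSign v f 0 * (z.re - ((f 0 : ℝ) + 1 / 2)) := by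
          rcases hs0 with h0 | h0 <;> rw [h0] at hq0 ⊢
          · rw [one_mul] at hq0 ⊢; exact abs_of_nonneg hq0
          · rw [neg_one_mul] at hq0 ⊢; exact abs_of_nonpos (by linarith)
        rw [habs]
        have hsq : cornerSign v f 0 * cornerSign v f 0 = 1 := by rcases hs0 with h | h <;> rw [h] <;> norm_num
        have hv0 : (v 0 : ℝ) = (f 0 : ℝ) + 1 / 2 + cornerSign v f 0 / 2 := by linarith
        rw [hv0]; linear_combination (z.re - ((f 0 : ℝ) + 1 / 2)) * hsq
      · simp only [AffineMap.lineMap_apply_module, Complex.add_im, Complex.smul_im, smul_eq_mul]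
        have habs1 : |z.im - ((f 1 : ℝ) + 1 / 2)| = cornerSign v f 1 * (z.im - ((f 1 : ℝ) + 1 / 2)) := by
          rcases hs1 with h1 | h1 <;> rw [h1] at hq1 ⊢
          · rw [one_mul] at hq1 ⊢; exact abs_of_nonneg hq1
          · rw [neg_one_mul] at hq1 ⊢; exact abs_of_nonpos (by linarith)
        have hx : 2 * |z.re - ((f 0 : ℝ) + 1 / 2)| = 1 - 2 * |z.im - ((f 1 : ℝ) + 1 / 2)| := by linarith
        rw [hx, habs1]
        have hsq : cornerSign v f 1 * cornerSign v f 1 = 1 := by rcases hs1 with h | h <;> rw [h] <;> norm_num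
        have hv1 : (v 1 : ℝ) = (f 1 : ℝ) + 1 / 2 + cornerSign v f 1 / 2 := by linarith
        rw [hv1]; linear_combination (z.im - ((f 1 : ℝ) + 1 / 2)) * hsq

/-- Points of a corner cut are at `ℓ¹` distance `½` from the face centre. [folklore] -/
theorem l1DistC_eq_of_mem_cornerCut {v f : Site 2} (hv : IsCorner v f) {z : ℂ} (hz : z ∈ cornerCut v f) :
    l1DistC z (faceCenter f) = 1 / 2 :=
  ((mem_cornerCut_iff hv).1 hz).1

/-- The endpoints of a corner cut, relative to the face centre: `c_f + (0, s₁/2)` (horizontal-edge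
midpoint) and `c_f + (s₀/2, 0)` (vertical-edge midpoint), `sᵢ = cornerSign v f i`. [folklore] -/
theorem medialPoint_cornerEdge_eq {v f : Site 2} (hv : IsCorner v f) :
    medialPoint 1 (cornerEdge v f 0) = ⟨(faceCenter f).re, (faceCenter f).im + cornerSign v f 1 / 2⟩ ∧
    medialPoint 1 (cornerEdge v f 1) = ⟨(faceCenter f).re + cornerSign v f 0 / 2, (faceCenter f).im⟩ := by
  have hc0 := corner_sub_faceCenter hv 0
  have hc1 := corner_sub_faceCenter hv 1
  rw [medialPoint_cornerEdge_zero, medialPoint_cornerEdge_one]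
  constructor <;> apply Complex.ext <;> simp <;> linarith

/-- The sign of a corner coordinate is `±1`. [folklore] -/
theorem cornerSign_eq_or (v f : Site 2) (i : Fin 2) : cornerSign v f i = 1 ∨ cornerSign v f i = -1 := by
  unfold cornerSign; split_ifs <;> simp

/-- A corner is determined by its face and its signs. [folklore] -/
theorem corner_ext {v v' f : Site 2} (hv : IsCorner v f) (hv' : IsCorner v' f)
    (h : ∀ i, cornerSign v f i = cornerSign v' f i) : v = v' := by
  funext i
  have h1 := corner_sub_faceCenter hv i
  have h2 := corner_sub_faceCenter hv' i
  rw [h i] at h1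
  have : (v i : ℝ) = v' i := by linarith
  exact_mod_cast this

/-- `1 ≤ |x| + |x - 1|`. [folklore] -/
private theorem one_le_abs_add_abs_sub_one (x : ℝ) : 1 ≤ |x| + |x - 1| := by
  have := abs_sub_le (1 : ℝ) x 0
  have h2 : |(1 : ℝ) - x| = |x - 1| := abs_sub_comm 1 x
  simp only [sub_zero, abs_one] at this
  linarith [h2]

/-- From `|x| + |y| = ½ = |x - 1| + |y|`: `x = ½` and `y = 0`. [folklore] -/
private theorem eq_of_l1_eq_half_of_shift {x y : ℝ} (h : |x| + |y| = 1 / 2) (h' : |x - 1| + |y| = 1 / 2) :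
    x = 1 / 2 ∧ y = 0 := by
  have h1 := one_le_abs_add_abs_sub_one x
  have hy : |y| = 0 := by linarith [abs_nonneg y]
  have hy0 : y = 0 := abs_eq_zero.1 hy
  rw [hy, add_zero] at h h'
  refine ⟨?_, hy0⟩
  rcases abs_eq (by norm_num : (0 : ℝ) ≤ 1 / 2) |>.1 h with hx | hx
  · exact hx
  · rw [hx] at h'; norm_num at h'

/-- **Two corner cuts meet at most in common endpoints.** If `(v, f) ≠ (v', f')` then every
common point of `cornerCut v f` and `cornerCut v' f'` is an endpoint (edge midpoint) of both.
Cuts of different faces lie on `ℓ¹`-spheres of radius `½` about centres at `ℓ¹` distance `≥ 1`,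
which meet only at the midpoint of the common edge, and the quadrant conditions make it an
endpoint of both; cuts of the same face at different corners lie in different closed quadrants,
which meet on the axes, where the sphere has only the four edge midpoints. [folklore] -/
theorem cornerCut_inter_subset {v f v' f' : Site 2} (hv : IsCorner v f) (hv' : IsCorner v' f')
    (hne : (v, f) ≠ (v', f')) :
    cornerCut v f ∩ cornerCut v' f' ⊆
      ({medialPoint 1 (cornerEdge v f 0), medialPoint 1 (cornerEdge v f 1)} ∩
        {medialPoint 1 (cornerEdge v' f' 0), medialPoint 1 (cornerEdge v' f' 1)}) := by
  intro z hz
  obtain ⟨hz1, hz2⟩ := hz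
  rw [mem_cornerCut_iff hv] at hz1
  rw [mem_cornerCut_iff hv'] at hz2
  obtain ⟨hd, hq0, hq1⟩ := hz1
  obtain ⟨hd', hq0', hq1'⟩ := hz2
  obtain ⟨hP0, hP1⟩ := medialPoint_cornerEdge_eq hv
  obtain ⟨hP0', hP1'⟩ := medialPoint_cornerEdge_eq hv'
  simp only [l1DistC, faceCenter_re, faceCenter_im] at hd hd' hq0 hq1 hq0' hq1'
  -- relative coordinates `x, y` (to `c_f`) and the integer offset `(m, n) = f' - f`
  set x : ℝ := z.re - ((f 0 : ℝ) + 1 / 2) with hx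
  set y : ℝ := z.im - ((f 1 : ℝ) + 1 / 2) with hy
  set m : ℤ := f' 0 - f 0 with hm
  set n : ℤ := f' 1 - f 1 with hn
  have hx' : z.re - ((f' 0 : ℝ) + 1 / 2) = x - m := by simp only [hx, hm]; push_cast; ring
  have hy' : z.im - ((f' 1 : ℝ) + 1 / 2) = y - n := by simp only [hy, hn]; push_cast; ring
  rw [hx'] at hd' hq0'
  rw [hy'] at hd' hq1'
  have hs0 := cornerSign_eq_or v f 0
  have hs1 := cornerSign_eq_or v f 1
  have hs0' := cornerSign_eq_or v' f' 0
  have hs1' := cornerSign_eq_or v' f' 1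
  -- the point in terms of `x, y`
  have hzeq : z = ⟨((f 0 : ℝ) + 1 / 2) + x, ((f 1 : ℝ) + 1 / 2) + y⟩ := by
    apply Complex.ext <;> simp [hx, hy]
  have hc' : (faceCenter f').re = ((f 0 : ℝ) + 1 / 2) + m ∧ (faceCenter f').im = ((f 1 : ℝ) + 1 / 2) + n := by
    simp only [faceCenter_re, faceCenter_im, hm, hn]; push_cast; constructor <;> ring
  -- `|m| ≤ 1`, `|n| ≤ 1`, not both nonzero
  have hm1 : |(m : ℝ)| ≤ 1 := by
    have := abs_sub_le (m : ℝ) x 0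
    have e : |(m : ℝ) - x| = |x - m| := abs_sub_comm _ _
    simp only [sub_zero] at this
    linarith [abs_nonneg y, abs_nonneg (y - n)]
  have hn1 : |(n : ℝ)| ≤ 1 := by
    have := abs_sub_le (n : ℝ) y 0
    have e : |(n : ℝ) - y| = |y - n| := abs_sub_comm _ _
    simp only [sub_zero] at this
    linarith [abs_nonneg x, abs_nonneg (x - m)]
  have hmn : ¬ (m ≠ 0 ∧ n ≠ 0) := by
    rintro ⟨hm0, hn0⟩
    have h1 : (1 : ℝ) ≤ |(m : ℝ)| := by exact_mod_cast Int.one_le_abs hm0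
    have h2 : (1 : ℝ) ≤ |(n : ℝ)| := by exact_mod_cast Int.one_le_abs hn0
    have h3 := abs_sub_le (m : ℝ) x 0
    have h4 := abs_sub_le (n : ℝ) y 0
    rw [abs_sub_comm (m : ℝ) x] at h3
    rw [abs_sub_comm (n : ℝ) y] at h4
    simp only [sub_zero] at h3 h4
    linarith
  have hmI : -1 ≤ m ∧ m ≤ 1 := by
    obtain ⟨h1, h2⟩ := abs_le.1 hm1
    exact ⟨by exact_mod_cast h1, by exact_mod_cast h2⟩
  have hnI : -1 ≤ n ∧ n ≤ 1 := by
    obtain ⟨h1, h2⟩ := abs_le.1 hn1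
    exact ⟨by exact_mod_cast h1, by exact_mod_cast h2⟩
  -- sign bookkeeping: `0 ≤ s t` with `s = ±1` pins the sign of `t`
  have sgn : ∀ {s t : ℝ}, s = 1 ∨ s = -1 → 0 ≤ s * t → 0 < t → s = 1 := by
    rintro s t (rfl | rfl) h ht
    · rfl
    · linarith
  have sgn' : ∀ {s t : ℝ}, s = 1 ∨ s = -1 → 0 ≤ s * t → t < 0 → s = -1 := by
    rintro s t (rfl | rfl) h ht
    · linarith
    · rfl
  obtain ⟨hmlo, hmhi⟩ := hmI
  obtain ⟨hnlo, hnhi⟩ := hnI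
  interval_cases m <;> interval_cases n
  all_goals try exact absurd ⟨by decide, by decide⟩ hmn
  · -- `(m, n) = (-1, 0)`: `z` is the midpoint of the common vertical edge, `x = -1/2`, `y = 0`
    push_cast at hd' hq0' hq1'
    simp only [sub_zero] at hd' hq1'
    obtain ⟨hxv, hyv⟩ := eq_of_l1_eq_half_of_shift (x := -x) (y := y) (by rwa [abs_neg])
      (by rw [show -x - 1 = -(x - -1) by ring, abs_neg]; exact hd')
    have hxv' : x = -(1 / 2) := by linarith
    have h0 : cornerSign v f 0 = -1 := sgn' hs0 hq0 (by linarith)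
    have h0' : cornerSign v' f' 0 = 1 := sgn hs0' hq0' (by linarith)
    refine ⟨Or.inr ?_, Or.inr ?_⟩
    · rw [hP1, hzeq, h0]; apply Complex.ext <;> simp [hyv, hxv']
      all_goals ring
    · rw [hP1', hzeq, hc'.1, hc'.2, h0']; apply Complex.ext <;> simp [hyv, hxv']
      all_goals ring
  · -- `(0, -1)`: midpoint of the common horizontal edge below, `x = 0`, `y = -1/2`
    push_cast at hd' hq0' hq1'
    simp only [sub_zero] at hd' hq0'
    obtain ⟨hyv, hxv⟩ := eq_of_l1_eq_half_of_shift (x := -y) (y := x) (by rw [abs_neg]; linarith)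
      (by rw [show -y - 1 = -(y - -1) by ring, abs_neg]; linarith)
    have hyv' : y = -(1 / 2) := by linarith
    have h1 : cornerSign v f 1 = -1 := sgn' hs1 hq1 (by linarith)
    have h1' : cornerSign v' f' 1 = 1 := sgn hs1' hq1' (by linarith)
    refine ⟨Or.inl ?_, Or.inl ?_⟩
    · rw [hP0, hzeq, h1]; apply Complex.ext <;> simp [hyv', hxv]
      all_goals ring
    · rw [hP0', hzeq, hc'.1, hc'.2, h1']; apply Complex.ext <;> simp [hyv', hxv]
      all_goals ring
  · -- `(0, 0)`: same face, different corners
    have hff : f = f' := by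
      funext i; fin_cases i
      · change f 0 = f' 0; omega
      · change f 1 = f' 1; omega
    subst hff
    have hvv : v ≠ v' := fun h ↦ hne (by rw [h])
    push_cast at hd' hq0' hq1'
    simp only [sub_zero] at hd' hq0' hq1'
    by_cases h0 : cornerSign v f 0 = cornerSign v' f 0
    · have h1 : cornerSign v f 1 ≠ cornerSign v' f 1 := fun h1 ↦
        hvv (corner_ext hv hv' fun i ↦ by fin_cases i <;> assumption)
      -- opposite vertical signs force `y = 0`, then `x = s₀ / 2`
      have hy0 : y = 0 := by
        rcases hs1 with e | e <;> rcases hs1' with e' | e' <;> rw [e] at hq1 h1 <;> rw [e'] at hq1' h1 <;>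
          first | exact absurd rfl h1 | linarith
      have hxa : |x| = 1 / 2 := by rw [hy0, abs_zero, add_zero] at hd; exact hd
      have hxv : x = cornerSign v f 0 / 2 := by
        rcases hs0 with e | e <;> rw [e] at hq0 ⊢
        · rw [abs_of_nonneg (by linarith)] at hxa; linarith
        · rw [abs_of_nonpos (by linarith)] at hxa; linarith
      refine ⟨Or.inr ?_, Or.inr ?_⟩
      · rw [hP1, hzeq]; apply Complex.ext <;> simp [hy0, hxv]
      · rw [hP1', hzeq, ← h0]; apply Complex.ext <;> simp [hy0, hxv]
    · -- opposite horizontal signs force `x = 0`, then `y = s₁ / 2` and the vertical signs agree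
      have hx0 : x = 0 := by
        rcases hs0 with e | e <;> rcases hs0' with e' | e' <;> rw [e] at hq0 h0 <;> rw [e'] at hq0' h0 <;>
          first | exact absurd rfl h0 | linarith
      have hya : |y| = 1 / 2 := by rw [hx0, abs_zero, zero_add] at hd; exact hd
      have hyv : y = cornerSign v f 1 / 2 := by
        rcases hs1 with e | e <;> rw [e] at hq1 ⊢
        · rw [abs_of_nonneg (by linarith)] at hya; linarith
        · rw [abs_of_nonpos (by linarith)] at hya; linarith
      have h1 : cornerSign v f 1 = cornerSign v' f 1 := by
        rcases hs1 with e | e <;> rcases hs1' with e' | e' <;> rw [e] at hyv ⊢ <;> rw [e'] at hq1' ⊢ <;>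
          first | rfl | (exfalso; linarith)
      refine ⟨Or.inl ?_, Or.inl ?_⟩
      · rw [hP0, hzeq]; apply Complex.ext <;> simp [hx0, hyv]
      · rw [hP0', hzeq, ← h1]; apply Complex.ext <;> simp [hx0, hyv]
  · -- `(0, 1)`: midpoint of the common horizontal edge above, `x = 0`, `y = 1/2`
    push_cast at hd' hq0' hq1'
    simp only [sub_zero] at hd' hq0'
    obtain ⟨hyv, hxv⟩ := eq_of_l1_eq_half_of_shift (x := y) (y := x) (by linarith) (by linarith)
    have h1 : cornerSign v f 1 = 1 := sgn hs1 hq1 (by linarith)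
    have h1' : cornerSign v' f' 1 = -1 := sgn' hs1' hq1' (by linarith)
    refine ⟨Or.inl ?_, Or.inl ?_⟩
    · rw [hP0, hzeq, h1]; apply Complex.ext <;> simp [hyv, hxv]
    · rw [hP0', hzeq, hc'.1, hc'.2, h1']; apply Complex.ext <;> simp [hyv, hxv]
      all_goals ring
  · -- `(1, 0)`: midpoint of the common vertical edge on the right, `x = 1/2`, `y = 0`
    push_cast at hd' hq0' hq1'
    simp only [sub_zero] at hd' hq1'
    obtain ⟨hxv, hyv⟩ := eq_of_l1_eq_half_of_shift hd hd'
    have h0 : cornerSign v f 0 = 1 := sgn hs0 hq0 (by linarith)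
    have h0' : cornerSign v' f' 0 = -1 := sgn' hs0' hq0' (by linarith)
    refine ⟨Or.inr ?_, Or.inr ?_⟩
    · rw [hP1, hzeq, h0]; apply Complex.ext <;> simp [hyv, hxv]
    · rw [hP1', hzeq, hc'.1, hc'.2, h0']; apply Complex.ext <;> simp [hyv, hxv]
      all_goals ring

/-! ### Medial darts trace corner cuts -/

/-- The segment traced by a medial dart is the corner cut of its corner (in either direction). [folklore] -/
theorem _root_.Literature.Probability.LatticeModels.IsMedialDart.exists_segment_eq_cornerCut {e e' : MedialVertex} (h : IsMedialDart e e') :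
    ∃ v f, IsCorner v f ∧ cornerSource v f = e ∧ cornerTarget v f = e' ∧
      segment ℝ (medialPoint 1 e) (medialPoint 1 e') = cornerCut v f := by
  obtain ⟨v, f, hv, rfl, rfl⟩ := h
  refine ⟨v, f, hv, rfl, rfl, ?_⟩
  unfold cornerSource cornerTarget cornerCut
  split_ifs
  · rfl
  · exact segment_symm ℝ _ _

/-- A corner cut is not contained in the set of its two endpoints (it has interior points). [folklore] -/
theorem cornerCut_not_subset_endpoints {v f : Site 2} (hv : IsCorner v f) :
    ¬ cornerCut v f ⊆ {medialPoint 1 (cornerEdge v f 0), medialPoint 1 (cornerEdge v f 1)} := by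
  intro hsub
  obtain ⟨hP0, hP1⟩ := medialPoint_cornerEdge_eq hv
  have hs0 := cornerSign_eq_or v f 0
  have hs1 := cornerSign_eq_or v f 1
  -- the midpoint of the cut
  have hmid : midpoint ℝ (medialPoint 1 (cornerEdge v f 0)) (medialPoint 1 (cornerEdge v f 1)) ∈ cornerCut v f :=
    midpoint_mem_segment _ _
  rcases hsub hmid with h | h
  · have := congrArg Complex.re h
    rw [hP0, hP1] at this
    simp [midpoint_eq_smul_add] at this
    rcases hs0 with e | e <;> rw [e] at this <;> linarith
  · rw [Set.mem_singleton_iff] at h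
    have := congrArg Complex.im h
    rw [hP0, hP1] at this
    simp [midpoint_eq_smul_add] at this
    rcases hs1 with e | e <;> rw [e] at this <;> linarith

/-- **Distinct medial darts trace cuts meeting only at common endpoints.** For medial darts
`(e₁, e₁') ≠ (e₂, e₂')`, every common point of their segments is an endpoint of both (a common
medial point; reversed darts cannot both be medial darts, `IsMedialDart.not_symm`). In particular a
closed medial circuit without repeated darts self-intersects only at doubly visited medial vertices. [folklore] -/
theorem _root_.Literature.Probability.LatticeModels.IsMedialDart.segment_inter_segment_subset {e₁ e₁' e₂ e₂' : MedialVertex} (h₁ : IsMedialDart e₁ e₁')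
    (h₂ : IsMedialDart e₂ e₂') (hne : (e₁, e₁') ≠ (e₂, e₂')) :
    segment ℝ (medialPoint 1 e₁) (medialPoint 1 e₁') ∩ segment ℝ (medialPoint 1 e₂) (medialPoint 1 e₂') ⊆
      ({medialPoint 1 e₁, medialPoint 1 e₁'} ∩ {medialPoint 1 e₂, medialPoint 1 e₂'}) := by
  obtain ⟨v₁, f₁, hv₁, hs₁, ht₁, hseg₁⟩ := h₁.exists_segment_eq_cornerCut
  obtain ⟨v₂, f₂, hv₂, hs₂, ht₂, hseg₂⟩ := h₂.exists_segment_eq_cornerCut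
  -- the corners are distinct
  have hc : (v₁, f₁) ≠ (v₂, f₂) := by
    intro h
    obtain ⟨rfl, rfl⟩ := Prod.mk.inj h
    exact hne (by rw [← hs₁, ← ht₁, ← hs₂, ← ht₂])
  have key := cornerCut_inter_subset hv₁ hv₂ hc
  -- endpoints of a cut are the dart's two medial points
  have hends : ∀ {v f : Site 2} {e e' : MedialVertex}, cornerSource v f = e → cornerTarget v f = e' →
      ({medialPoint 1 (cornerEdge v f 0), medialPoint 1 (cornerEdge v f 1)} : Set ℂ) = {medialPoint 1 e, medialPoint 1 e'} := by
    intro v f e e' hs ht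
    subst hs; subst ht
    unfold cornerSource cornerTarget
    split_ifs
    · rfl
    · exact Set.pair_comm _ _
  rw [hseg₁, hseg₂, ← hends hs₁ ht₁, ← hends hs₂ ht₂]
  exact key

/-- A medial dart and its reverse are never both medial darts (the reversed pair keeps the
primal vertex on the right). [folklore] -/
theorem _root_.Literature.Probability.LatticeModels.IsMedialDart.not_symm {e e' : MedialVertex} (h : IsMedialDart e e') : ¬ IsMedialDart e' e := by
  intro h'
  obtain ⟨v₁, f₁, hv₁, hs₁, ht₁, hseg₁⟩ := h.exists_segment_eq_cornerCut
  obtain ⟨v₂, f₂, hv₂, hs₂, ht₂, hseg₂⟩ := h'.exists_segment_eq_cornerCut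
  by_cases hc : (v₁, f₁) = (v₂, f₂)
  · obtain ⟨rfl, rfl⟩ := Prod.mk.inj hc
    -- then `e = e'`, contradicting `IsMedialDart.ne`
    exact h.ne (hs₁.symm.trans hs₂)
  · -- the two cuts coincide as sets, so the cut lies in its endpoint set: impossible
    have key := cornerCut_inter_subset hv₁ hv₂ hc
    rw [← hseg₁, ← hseg₂, segment_symm ℝ (medialPoint 1 e'), Set.inter_self] at key
    refine cornerCut_not_subset_endpoints hv₁ ?_
    rw [← hseg₁]
    exact fun z hz ↦ (key hz).1

end Literature.Probability.Percolation

end
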